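import Literature.AlgebraicGeometry.HodgeTheory.NodalPencilModelIsotopy
import Literature.AlgebraicGeometry.HodgeTheory.CyclicCoverPencilSlice
import Literature.AlgebraicGeometry.HodgeTheory.CyclicCoverPencilModelIsotopyRadius
import Literature.Geometry.Manifold.ShellInterpolatedIsotopyPunctured
import Literature.Geometry.Manifold.ShellInterpolatedIsotopyInverse
import Mathlib.Analysis.SpecialFunctions.SmoothTransition
import HarnessLib

/-!
# The geometric monodromy map of a monomial pencil near a node, on the pencil slice (shell interpolation of the model
# isotopy and the fold isotopy)

Family `hodge`, layer `Literature/AlgebraicGeometry/HodgeTheory`. Written by the prover seat `hodge-nonav-prover-Bx` (g15, cell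
`hodge-nonav`) as a brick of the ODP-ISOTOPY port (memo `PROGRAMME-ODP-ISOTOPY-Bx-g13` §2; Picard–Lefschetz binder hPL₁
`picardLefschetz_oneNode` of crux K1-B, stmt-HodgeConjecture-19716): the generalisation of the `cutRadius` half of prover-Ax's
`CyclicCoverPencilSlice` and of `CyclicCoverPencilMonodromyMap(Inverse)` (steps A3c, A3c′ for the quaternary cyclic pencil `x₃^p = f₁ + c·x₂^p`) to an
ARBITRARY degree `d ≥ 1`, `n + 2` variables, chart `xᵢ ≠ 0`, monomial pencil direction `xᵢ^d` and an ordinary double point (all Morse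
weights `2`): the classical construction of the geometric monodromy of the pencil around its nodal member (Arnold–Gusein-Zade–Varchenko
II Part I §1.1, §2.1; Milnor §9 Lemma 9.4), assembled on the pencil slice `S = pencilSlice n d i b₀ ⊆ 𝒴°(ℂ)` from
* the MODEL isotopy `J(θ, x) = chartModelIsotopy (fun _ ↦ 2) Φ Θ θ x` (`NodalPencilModelIsotopy`), read as a self-map of `S` through
  `restrictIf` (`CyclicCoverPencilSlice`, generic);
* a FOLD isotopy `g` of `𝒴°(ℂ)` (the output of `NodalPencilFoldIsotopy.exists_pencil_foldIsotopy_invariant`, taken here as data with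
  its seven properties), which preserves the slice;
* the radius function `cutRadius` (`= F` over the disc `|c| ≤ ρW/4`, `≥ T` off `|c| < ρW/2`) and the continuous cut-off
  `λ(t) = σ((t − t₁)/(t₂ − t₁))`,
by the punctured shell interpolation `Geometry/Manifold/ShellInterpolatedIsotopyPunctured` (radii `s₁² ≤ t₁ < t₂ ≤ T' < T`, disc
`|c| < δ₀ ≤ ρW/4`).

* `cutRadius`, `satRadius_le_cutRadius`, `cutRadius_eq_of_norm_le`, `norm_lt_of_cutRadius_lt`, `continuous_cutRadius`;
* `monodromyMap_good`, `monodromyMap_model_spec`, `monodromyMap_model_coe`, `monodromyMap_hI`, `_hI0`, `_hIadd`, `_hIcont` (the model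
  isotopy on the slice satisfies the hypotheses of the shell interpolation), `monodromyMap_fold_coe`, `_cutRadius_eq`, `_hgO`, `_hgadd`,
  `_hgρ`, `_hgcont` (so does the fold isotopy);
* `exists_pencil_monodromyMap` — **self-maps `h, k, H` of `ℝ × S` with, over the punctured disc `0 < |c| < δ₀`: `h` continuous,
  `h(0, ·) = id`, `c(h(u, x)) = e^{2πiu} c(x)`, `F` preserved below `T` and kept above `T'`, `k(u, ·)` a two-sided inverse of `h(u, ·)`,
  `h(1, ·) = id` where `F ≥ t₂`, and the homotopy `H(s, ·)` inside each fibre-ball `{c = const, F < T}` from `H(0, ·) = J(2π, ·)` (the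
  ANTIPODAL map of the Morse coordinates) to `H(1, ·) = h(1, ·)` (where `F ≤ T'`).**

Everything is proved; the one definition (`cutRadius`) is concrete; no named facts. Honest scope: plumbing of the classical construction
of the geometric monodromy of a pencil near an ordinary double point; nothing here says HC or any rung is proved.

## References

* [ArnoldGuseinzadeVarchenko2012] V. I. Arnold, S. M. Gusein-Zade, A. N. Varchenko, Singularities of Differentiable Maps II (2012),
  Part I §1.1, §2.1.
* [Milnor1968] J. Milnor, Singular Points of Complex Hypersurfaces, §9 Lemma 9.4.
-/

noncomputable section

open CategoryTheory AlgebraicGeometry MvPolynomial TopologicalSpace Set Topology Filter Complex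
open scoped Manifold ContDiff Real
open Literature.AlgebraicGeometry.Motives Literature.AlgebraicGeometry.Motives.UniversalHypersurface
open Literature.AlgebraicGeometry.HodgeTheory.UniversalHypersurface Literature.Geometry.ComplexAnalytic Literature.Geometry.Manifold

namespace Literature.AlgebraicGeometry.HodgeTheory

namespace NodalPencil

/-! ### The cut radius -/

section CutRadius

variable (n d : ℕ) (i : Fin (n + 2)) (Θ : OpenPartialHomeomorph (Fin (n + 1) → ℂ) (Fin (n + 1) → ℂ)) (R''' R'' : ℝ)
  (b₀ : DegIndex n d → ℂ) (T ρW : ℝ)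

/-- **The cut radius** `max (F(Q)) (T · σ(4|c(Q)|/ρW − 1))` (`σ` = `Real.smoothTransition`): equal to `F` over the disc `|c| ≤ ρW/4`,
at least `T` off the disc `|c| < ρW/2`. [cite: ArnoldGuseinzadeVarchenko2012, Part I §1.1] -/
def cutRadius (Q : ComplexPoints (regularTotal ℂ n d)) : ℝ :=
  max (satRadius n d i Θ R''' R'' Q) (T * Real.smoothTransition (4 * ‖pencilCoord n d i b₀ Q‖ / ρW - 1))

/-- `F ≤ cutRadius`. [cite: ArnoldGuseinzadeVarchenko2012, Part I §1.1] -/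
theorem satRadius_le_cutRadius (Q : ComplexPoints (regularTotal ℂ n d)) :
    satRadius n d i Θ R''' R'' Q ≤ cutRadius n d i Θ R''' R'' b₀ T ρW Q :=
  le_max_left _ _

/-- **Over the small disc the cut radius is the saturated Morse radius**: `|c(Q)| ≤ ρW/4`, `ρW > 0`, `F(Q) ≥ 0` ⇒ `cutRadius Q = F(Q)`.
[cite: ArnoldGuseinzadeVarchenko2012, Part I §1.1] -/
theorem cutRadius_eq_of_norm_le (hρW : 0 < ρW) {Q : ComplexPoints (regularTotal ℂ n d)}
    (hQ : ‖pencilCoord n d i b₀ Q‖ ≤ ρW / 4) (hF : 0 ≤ satRadius n d i Θ R''' R'' Q) :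
    cutRadius n d i Θ R''' R'' b₀ T ρW Q = satRadius n d i Θ R''' R'' Q := by
  have harg : 4 * ‖pencilCoord n d i b₀ Q‖ / ρW - 1 ≤ 0 := by
    rw [sub_nonpos, div_le_one hρW]; linarith
  rw [cutRadius, Real.smoothTransition.zero_of_nonpos harg, mul_zero, max_eq_left hF]

/-- **The ball `{cutRadius < T}` lies over the disc `|c| < ρW/2`** (`ρW > 0`). [cite: ArnoldGuseinzadeVarchenko2012, Part I §1.1] -/
theorem norm_lt_of_cutRadius_lt (hρW : 0 < ρW) {Q : ComplexPoints (regularTotal ℂ n d)}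
    (hQ : cutRadius n d i Θ R''' R'' b₀ T ρW Q < T) : ‖pencilCoord n d i b₀ Q‖ < ρW / 2 := by
  have h1 : T * Real.smoothTransition (4 * ‖pencilCoord n d i b₀ Q‖ / ρW - 1) < T := lt_of_le_of_lt (le_max_right _ _) hQ
  have h2 : Real.smoothTransition (4 * ‖pencilCoord n d i b₀ Q‖ / ρW - 1) < 1 := by
    by_contra h
    have h' : Real.smoothTransition (4 * ‖pencilCoord n d i b₀ Q‖ / ρW - 1) = 1 :=
      le_antisymm (Real.smoothTransition.le_one _) (not_lt.mp h)
    rw [h', mul_one] at h1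
    exact lt_irrefl _ h1
  have h3 : 4 * ‖pencilCoord n d i b₀ Q‖ / ρW - 1 < 1 := by
    by_contra h
    exact absurd (Real.smoothTransition.one_of_one_le (not_lt.mp h)) h2.ne
  rw [sub_lt_iff_lt_add, div_lt_iff₀ hρW] at h3
  linarith

/-- `F < T` on the ball `{cutRadius < T}`. [cite: ArnoldGuseinzadeVarchenko2012, Part I §1.1] -/
theorem satRadius_lt_of_cutRadius_lt {Q : ComplexPoints (regularTotal ℂ n d)}
    (hQ : cutRadius n d i Θ R''' R'' b₀ T ρW Q < T) : satRadius n d i Θ R''' R'' Q < T :=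
  lt_of_le_of_lt (satRadius_le_cutRadius n d i Θ R''' R'' b₀ T ρW Q) hQ

/-- **The cut radius is continuous** (`d ≥ 1`, `Θ` smooth, `{Σ|z|² ≤ R''} ⊆ Θ.target`, `R''' < R''`).
[cite: ArnoldGuseinzadeVarchenko2012, Part I §1.1] -/
theorem continuous_cutRadius (hd : 0 < d) (hΘ : ContDiffOn ℝ ∞ Θ Θ.source) (hR : R''' < R'')
    (hR'' : {z : Fin (n + 1) → ℂ | ∑ j, ‖z j‖ ^ 2 ≤ R''} ⊆ Θ.target) :
    Continuous (cutRadius n d i Θ R''' R'' b₀ T ρW) := by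
  refine (continuous_satRadius n d i Θ R''' R'' hd hΘ hR hR'').max (continuous_const.mul ?_)
  exact Real.smoothTransition.continuous.comp
    ((((continuous_const.mul (continuous_pencilCoord n d i b₀ hd).norm).div_const ρW)).sub continuous_const)

/-- `cutRadius` only depends on `F` and `|c|`. [cite: ArnoldGuseinzadeVarchenko2012, Part I §1.1] -/
theorem cutRadius_congr {x x' : ComplexPoints (regularTotal ℂ n d)}
    (hF : satRadius n d i Θ R''' R'' x' = satRadius n d i Θ R''' R'' x)
    (hc : ‖pencilCoord n d i b₀ x'‖ = ‖pencilCoord n d i b₀ x‖) :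
    cutRadius n d i Θ R''' R'' b₀ T ρW x' = cutRadius n d i Θ R''' R'' b₀ T ρW x := by
  simp only [cutRadius, hF, hc]

end CutRadius

section MonodromyMap

variable {n d : ℕ} {i : Fin (n + 2)} (hd : 0 < d) (b₀ : DegIndex n d → ℂ)
  (Φ : OpenPartialHomeomorph (ComplexPoints (regularTotal ℂ n d)) (({m : DegIndex n d // m ≠ regPowIndex n d i} ⊕ Fin (n + 1)) → ℂ))
  (hΦ : ⇑Φ = regChartFun n d i) (hΦs : Φ.source = regChartDom n d i) (hΦt : Φ.target = regChartFun n d i '' regChartDom n d i)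
  (Θ : OpenPartialHomeomorph (Fin (n + 1) → ℂ) (Fin (n + 1) → ℂ)) {r R''' R'' : ℝ}
  (hr : {z : Fin (n + 1) → ℂ | ∑ j, ‖z j‖ ^ 2 ≤ r ^ 2} ⊆ Θ.target)
  (φ : (Fin (n + 1) → ℂ) → ℂ)
  (hφ : ∀ y, φ y = regChartCoeffVec n d i
    (Sum.elim (fun m : {m : DegIndex n d // m ≠ regPowIndex n d i} => b₀ m.1) y) (regPowIndex n d i) - b₀ (regPowIndex n d i))
  (hΘφ : ∀ y ∈ Θ.source, ∑ j, (Θ y j) ^ 2 = φ y)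
  {ρW : ℝ} (hρW : 0 < ρW)
  (hns : ∀ c : ℂ, c ≠ 0 → ‖c‖ < ρW →
    SmoothHypersurface.IsNonsingularForm ℂ (formOfCoeffs (b₀ + Pi.single (regPowIndex n d i) c)))
  (hR : R''' < R'') {T : ℝ} (hTR : T ≤ R''') (hTr : T ≤ r ^ 2)
include hd hΦ hΦs hΦt hr hφ hΘφ hρW hns hR hTR hTr

/-! ### The model isotopy at the good points of the slice -/

omit hρW in
/-- **The data of a good point**: `x ∈ S`, `F(x) < T`, `0 < |c(x)| < ρW` ⇒ `x ∈ Φ.source`, `y(x) ∈ Θ.source`, `Σ|Θ y(x)|² < r²`,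
`Σ|Θ y(x)|² ≤ R'''`. [cite: Milnor1968, §9 Lemma 9.4] -/
theorem monodromyMap_good {x : ComplexPoints (regularTotal ℂ n d)} (hxS : x ∈ pencilSlice n d i b₀)
    (hF : satRadius n d i Θ R''' R'' x < T) (hc0 : pencilCoord n d i b₀ x ≠ 0) (hcρ : ‖pencilCoord n d i b₀ x‖ < ρW) :
    x ∈ Φ.source ∧ (fun j => regChartFun n d i x (Sum.inr j)) ∈ Θ.source ∧
      ∑ k, ‖Θ (fun j => regChartFun n d i x (Sum.inr j)) k‖ ^ 2 < r ^ 2 ∧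
      ∑ k, ‖Θ (fun j => regChartFun n d i x (Sum.inr j)) k‖ ^ 2 ≤ R''' := by
  obtain ⟨hx, hy, hyr, -⟩ := mem_goodSet_of_satRadius_lt hd b₀ Φ hΦ hΦs hΦt Θ hr φ hφ hΘφ hns hR hTR hTr hxS hF hc0 hcρ
  obtain ⟨-, -, hSig⟩ := mem_of_satRadius_lt n d i Θ R''' R'' hR (lt_of_lt_of_le hF hTR)
  rw [hΦ] at hy hyr
  exact ⟨hx, hy, hyr, by rw [hSig]; exact (lt_of_lt_of_le hF hTR).le⟩

omit hρW in
/-- **At a good point the model isotopy stays in the slice, with `c ↦ e^{iθ}c` and `F` preserved.**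
[cite: Milnor1968, §9 Lemma 9.4] [cite: ArnoldGuseinzadeVarchenko2012, Part I §2.1] -/
theorem monodromyMap_model_spec {x : ComplexPoints (regularTotal ℂ n d)} (hxS : x ∈ pencilSlice n d i b₀)
    (hF : satRadius n d i Θ R''' R'' x < T) (hc0 : pencilCoord n d i b₀ x ≠ 0) (hcρ : ‖pencilCoord n d i b₀ x‖ < ρW)
    (θ : ℝ) :
    chartModelIsotopy (fun _ : Fin (n + 1) => 2) Φ Θ θ x ∈ pencilSlice n d i b₀ ∧
      pencilCoord n d i b₀ (chartModelIsotopy (fun _ : Fin (n + 1) => 2) Φ Θ θ x) =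
        Complex.exp ((θ : ℂ) * I) * pencilCoord n d i b₀ x ∧
      satRadius n d i Θ R''' R'' (chartModelIsotopy (fun _ : Fin (n + 1) => 2) Φ Θ θ x) = satRadius n d i Θ R''' R'' x := by
  obtain ⟨hx, hy, hyr, hyR⟩ := monodromyMap_good hd b₀ Φ hΦ hΦs hΦt Θ hr φ hφ hΘφ hns hR hTR hTr hxS hF hc0 hcρ
  exact ⟨chartModelIsotopy_mem_pencilSlice hd b₀ Φ hΦ hΦs hΦt Θ hr φ hφ hΘφ hns hx hxS hy hyr hc0 hcρ θ,
    pencilCoord_chartModelIsotopy hd b₀ Φ hΦ hΦs hΦt Θ hr φ hφ hΘφ hns hx hxS hy hyr hc0 hcρ θ,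
    satRadius_chartModelIsotopy hd b₀ Φ hΦ hΦs hΦt Θ hr φ hφ hΘφ hns hx hxS hy hyr hc0 hcρ θ hR hyR⟩

omit hρW in
/-- **On the slice, as a self-map**: at a good point `restrictIf S (J θ) x = J(θ, x)`. [cite: Milnor1968, §9 Lemma 9.4] -/
theorem monodromyMap_model_coe {x : pencilSlice n d i b₀}
    (hF : satRadius n d i Θ R''' R'' x.1 < T) (hc0 : pencilCoord n d i b₀ x.1 ≠ 0) (hcρ : ‖pencilCoord n d i b₀ x.1‖ < ρW)
    (θ : ℝ) :
    (restrictIf (pencilSlice n d i b₀) (chartModelIsotopy (fun _ : Fin (n + 1) => 2) Φ Θ θ) x :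
        ComplexPoints (regularTotal ℂ n d)) = chartModelIsotopy (fun _ : Fin (n + 1) => 2) Φ Θ θ x.1 :=
  restrictIf_coe _ _ (monodromyMap_model_spec hd b₀ Φ hΦ hΦs hΦt Θ hr φ hφ hΘφ hns hR hTR hTr x.2 hF hc0 hcρ θ).1

omit hd hΦ hΦs hΦt hr hφ hΘφ hns hR hTR hTr in
/-- **Points of the ball `{cutRadius < T}` are good.** [cite: ArnoldGuseinzadeVarchenko2012, Part I §1.1] -/
theorem monodromyMap_good_of_cutRadius_lt {x : ComplexPoints (regularTotal ℂ n d)}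
    (hρ : cutRadius n d i Θ R''' R'' b₀ T ρW x < T) :
    satRadius n d i Θ R''' R'' x < T ∧ ‖pencilCoord n d i b₀ x‖ < ρW :=
  ⟨satRadius_lt_of_cutRadius_lt n d i Θ R''' R'' b₀ T ρW hρ,
    lt_of_lt_of_le (norm_lt_of_cutRadius_lt n d i Θ R''' R'' b₀ T ρW hρW hρ) (by linarith)⟩

/-- **Hypothesis `hI` of the shell interpolation** for `J` read on the slice with `ρ = cutRadius`, `p = c`.
[cite: ArnoldGuseinzadeVarchenko2012, Part I §1.1] [cite: Milnor1968, §9 Lemma 9.4] -/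
theorem monodromyMap_hI (θ : ℝ) (x : pencilSlice n d i b₀) (hρ : cutRadius n d i Θ R''' R'' b₀ T ρW x.1 < T)
    (hc0 : pencilCoord n d i b₀ x.1 ≠ 0) :
    cutRadius n d i Θ R''' R'' b₀ T ρW
        (restrictIf (pencilSlice n d i b₀) (chartModelIsotopy (fun _ : Fin (n + 1) => 2) Φ Θ θ) x).1 =
        cutRadius n d i Θ R''' R'' b₀ T ρW x.1 ∧
      pencilCoord n d i b₀ (restrictIf (pencilSlice n d i b₀) (chartModelIsotopy (fun _ : Fin (n + 1) => 2) Φ Θ θ) x).1 =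
        Complex.exp ((θ : ℂ) * I) * pencilCoord n d i b₀ x.1 := by
  obtain ⟨hF, hcρ⟩ := monodromyMap_good_of_cutRadius_lt b₀ Θ hρW hρ
  obtain ⟨-, hc, hFJ⟩ := monodromyMap_model_spec hd b₀ Φ hΦ hΦs hΦt Θ hr φ hφ hΘφ hns hR hTR hTr x.2 hF hc0 hcρ θ
  rw [monodromyMap_model_coe hd b₀ Φ hΦ hΦs hΦt Θ hr φ hφ hΘφ hns hR hTR hTr hF hc0 hcρ θ]
  refine ⟨cutRadius_congr n d i Θ R''' R'' b₀ T ρW hFJ ?_, hc⟩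
  rw [hc, norm_mul, Complex.norm_exp_ofReal_mul_I, one_mul]

/-- **Hypothesis `hI0`**: `J(0, ·) = id` on the ball over the punctured plane. [cite: Milnor1968, §9 Lemma 9.4] -/
theorem monodromyMap_hI0 (x : pencilSlice n d i b₀) (hρ : cutRadius n d i Θ R''' R'' b₀ T ρW x.1 < T)
    (hc0 : pencilCoord n d i b₀ x.1 ≠ 0) :
    restrictIf (pencilSlice n d i b₀) (chartModelIsotopy (fun _ : Fin (n + 1) => 2) Φ Θ 0) x = x := by
  obtain ⟨hF, hcρ⟩ := monodromyMap_good_of_cutRadius_lt b₀ Θ hρW hρ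
  obtain ⟨hx, hy, -⟩ := monodromyMap_good hd b₀ Φ hΦ hΦs hΦt Θ hr φ hφ hΘφ hns hR hTR hTr x.2 hF hc0 hcρ
  refine restrictIf_of_apply_eq _ _ ?_
  rw [← hΦ] at hy
  exact chartModelIsotopy_zero_of_mem (fun _ : Fin (n + 1) => 2) Φ Θ hx hy

/-- **Hypothesis `hIadd`**: the flow law of `J` on the ball over the punctured plane. [cite: Milnor1968, §9 Lemma 9.4] -/
theorem monodromyMap_hIadd (θ θ' : ℝ) (x : pencilSlice n d i b₀) (hρ : cutRadius n d i Θ R''' R'' b₀ T ρW x.1 < T)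
    (hc0 : pencilCoord n d i b₀ x.1 ≠ 0) :
    restrictIf (pencilSlice n d i b₀) (chartModelIsotopy (fun _ : Fin (n + 1) => 2) Φ Θ (θ + θ')) x =
      restrictIf (pencilSlice n d i b₀) (chartModelIsotopy (fun _ : Fin (n + 1) => 2) Φ Θ θ)
        (restrictIf (pencilSlice n d i b₀) (chartModelIsotopy (fun _ : Fin (n + 1) => 2) Φ Θ θ') x) := by
  obtain ⟨hF, hcρ⟩ := monodromyMap_good_of_cutRadius_lt b₀ Θ hρW hρ
  obtain ⟨hx, hy, hyr, -⟩ := monodromyMap_good hd b₀ Φ hΦ hΦs hΦt Θ hr φ hφ hΘφ hns hR hTR hTr x.2 hF hc0 hcρ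
  obtain ⟨-, hc', hF'⟩ := monodromyMap_model_spec hd b₀ Φ hΦ hΦs hΦt Θ hr φ hφ hΘφ hns hR hTR hTr x.2 hF hc0 hcρ θ'
  have hF'' : satRadius n d i Θ R''' R''
      (restrictIf (pencilSlice n d i b₀) (chartModelIsotopy (fun _ : Fin (n + 1) => 2) Φ Θ θ') x).1 < T := by
    rw [monodromyMap_model_coe hd b₀ Φ hΦ hΦs hΦt Θ hr φ hφ hΘφ hns hR hTR hTr hF hc0 hcρ θ', hF']; exact hF
  have hc0'' : pencilCoord n d i b₀
      (restrictIf (pencilSlice n d i b₀) (chartModelIsotopy (fun _ : Fin (n + 1) => 2) Φ Θ θ') x).1 ≠ 0 := by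
    rw [monodromyMap_model_coe hd b₀ Φ hΦ hΦs hΦt Θ hr φ hφ hΘφ hns hR hTR hTr hF hc0 hcρ θ', hc']
    exact mul_ne_zero (Complex.exp_ne_zero _) hc0
  have hcρ'' : ‖pencilCoord n d i b₀
      (restrictIf (pencilSlice n d i b₀) (chartModelIsotopy (fun _ : Fin (n + 1) => 2) Φ Θ θ') x).1‖ < ρW := by
    rw [monodromyMap_model_coe hd b₀ Φ hΦ hΦs hΦt Θ hr φ hφ hΘφ hns hR hTR hTr hF hc0 hcρ θ', hc', norm_mul,
      Complex.norm_exp_ofReal_mul_I, one_mul]; exact hcρ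
  apply Subtype.ext
  rw [monodromyMap_model_coe hd b₀ Φ hΦ hΦs hΦt Θ hr φ hφ hΘφ hns hR hTR hTr hF hc0 hcρ,
    monodromyMap_model_coe hd b₀ Φ hΦ hΦs hΦt Θ hr φ hφ hΘφ hns hR hTR hTr hF'' hc0'' hcρ'',
    monodromyMap_model_coe hd b₀ Φ hΦ hΦs hΦt Θ hr φ hφ hΘφ hns hR hTR hTr hF hc0 hcρ]
  exact chartModelIsotopy_add hd b₀ Φ hΦ hΦs hΦt Θ hr φ hφ hΘφ hns hx x.2 hy hyr hc0 hcρ θ' θ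

/-- **Hypothesis `hIcont`**: `(θ, x) ↦ J(θ, x)` is continuous on `ℝ × ({cutRadius < T} ∩ {c ≠ 0})` (as a map of the slice).
[cite: Milnor1968, §9 Lemma 9.4] -/
theorem monodromyMap_hIcont :
    ContinuousOn (fun q : ℝ × pencilSlice n d i b₀ =>
        restrictIf (pencilSlice n d i b₀) (chartModelIsotopy (fun _ : Fin (n + 1) => 2) Φ Θ q.1) q.2)
      (univ ×ˢ {x : pencilSlice n d i b₀ | cutRadius n d i Θ R''' R'' b₀ T ρW x.1 < T ∧ pencilCoord n d i b₀ x.1 ≠ 0}) := by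
  have key : ContinuousOn (fun q : ℝ × pencilSlice n d i b₀ =>
      chartModelIsotopy (fun _ : Fin (n + 1) => 2) Φ Θ q.1 q.2.1)
      (univ ×ˢ {x : pencilSlice n d i b₀ | cutRadius n d i Θ R''' R'' b₀ T ρW x.1 < T ∧ pencilCoord n d i b₀ x.1 ≠ 0}) := by
    refine (continuousOn_chartModelIsotopy (fun _ : Fin (n + 1) => 2) Φ Θ hr).comp
      (continuous_fst.prodMk (continuous_subtype_val.comp continuous_snd)).continuousOn ?_
    rintro ⟨θ, x⟩ ⟨-, hρ, hc0⟩
    obtain ⟨hF, hcρ⟩ := monodromyMap_good_of_cutRadius_lt b₀ Θ hρW hρ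
    obtain ⟨hx, hy, hyr, hθ⟩ := mem_goodSet_of_satRadius_lt hd b₀ Φ hΦ hΦs hΦt Θ hr φ hφ hΘφ hns hR hTR hTr x.2 hF hc0 hcρ
    exact ⟨mem_univ _, hx, hy, hyr, hθ⟩
  rw [Topology.IsInducing.subtypeVal.continuousOn_iff]
  refine key.congr ?_
  rintro ⟨θ, x⟩ ⟨-, hρ, hc0⟩
  obtain ⟨hF, hcρ⟩ := monodromyMap_good_of_cutRadius_lt b₀ Θ hρW hρ
  exact monodromyMap_model_coe hd b₀ Φ hΦ hΦs hΦt Θ hr φ hφ hΘφ hns hR hTR hTr hF hc0 hcρ θ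

/-! ### The fold isotopy on the slice -/

variable (hT0 : 0 < T) (g : ℝ × ComplexPoints (regularTotal ℂ n d) → ComplexPoints (regularTotal ℂ n d)) (hgc : Continuous g)
  (hg0 : ∀ q, g (0, q) = q) (hg2π : ∀ q, g (2 * π, q) = q) {s₀ s₁ r₂ : ℝ}
  (hgO : ∀ θ, ∀ q ∈ invariantSet n d i Θ R''' R'' b₀ s₁, ‖pencilCoord n d i b₀ q‖ < ρW →
    g (θ, q) ∈ invariantSet n d i Θ R''' R'' b₀ s₁ ∧
      pencilCoord n d i b₀ (g (θ, q)) = Complex.exp (θ * I) * pencilCoord n d i b₀ q)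
  (hgadd : ∀ θ θ', ∀ q ∈ invariantSet n d i Θ R''' R'' b₀ s₁, ‖pencilCoord n d i b₀ q‖ < ρW →
    g (θ + θ', q) = g (θ, g (θ', q)))
  (hgS : ∀ θ q, q ∈ pencilSlice n d i b₀ → g (θ, q) ∈ pencilSlice n d i b₀)
  (hgF : ∀ θ q, q ∈ pencilSlice n d i b₀ → s₀ ^ 2 < satRadius n d i Θ R''' R'' q → satRadius n d i Θ R''' R'' q < r₂ ^ 2 →
    satRadius n d i Θ R''' R'' (g (θ, q)) = satRadius n d i Θ R''' R'' q)
  (hs₀₁ : s₀ ^ 2 < s₁ ^ 2) (hTr₂ : T ≤ r₂ ^ 2) {δ₀ : ℝ} (hδ₀ : δ₀ ≤ ρW / 4)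
include hT0 hgc hg0 hg2π hgO hgadd hgS hgF hs₀₁ hTr₂ hδ₀

omit hd hΦ hΦs hΦt hr hφ hΘφ hρW hns hR hTR hTr hT0 hgc hg0 hg2π hgO hgadd hgF hs₀₁ hTr₂ hδ₀ in
/-- **The fold isotopy as a self-map of the slice**: `restrictIf S (g(θ, ·)) q = g(θ, q)`. [cite: ArnoldGuseinzadeVarchenko2012, Part I §2.1] -/
theorem monodromyMap_fold_coe (θ : ℝ) (q : pencilSlice n d i b₀) :
    (restrictIf (pencilSlice n d i b₀) (fun x => g (θ, x)) q : ComplexPoints (regularTotal ℂ n d)) = g (θ, q.1) :=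
  restrictIf_coe _ _ (hgS θ q.1 q.2)

omit hd hΦ hΦs hΦt hr hφ hΘφ hns hTr hgc hg0 hg2π hgO hgadd hgS hgF hs₀₁ hTr₂ in
/-- Over the disc `|c| < δ₀ ≤ ρW/4` the cut radius is `F`. [cite: ArnoldGuseinzadeVarchenko2012, Part I §1.1] -/
theorem monodromyMap_cutRadius_eq {q : ComplexPoints (regularTotal ℂ n d)} (hq : ‖pencilCoord n d i b₀ q‖ < δ₀) :
    cutRadius n d i Θ R''' R'' b₀ T ρW q = satRadius n d i Θ R''' R'' q :=
  cutRadius_eq_of_norm_le n d i Θ R''' R'' b₀ T ρW hρW (by linarith)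
    (satRadius_nonneg n d i Θ R''' R'' hR (by linarith) q)

omit hd hΦ hΦs hΦt hr hφ hΘφ hns hTr hgc hg0 hg2π hgadd hgF hs₀₁ hTr₂ in
/-- **Hypothesis `hgO`** of the shell interpolation for `g` on the slice (`s₀ := s₁²`, disc `|c| < δ₀`).
[cite: ArnoldGuseinzadeVarchenko2012, Part I §2.1] -/
theorem monodromyMap_hgO (θ : ℝ) (q : pencilSlice n d i b₀) (hρ : s₁ ^ 2 < cutRadius n d i Θ R''' R'' b₀ T ρW q.1)
    (hq : ‖pencilCoord n d i b₀ q.1‖ < δ₀) :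
    s₁ ^ 2 < cutRadius n d i Θ R''' R'' b₀ T ρW (restrictIf (pencilSlice n d i b₀) (fun x => g (θ, x)) q).1 ∧
      pencilCoord n d i b₀ (restrictIf (pencilSlice n d i b₀) (fun x => g (θ, x)) q).1 =
        Complex.exp ((θ : ℂ) * I) * pencilCoord n d i b₀ q.1 := by
  rw [monodromyMap_cutRadius_eq b₀ Θ hρW hR hTR hT0 hδ₀ hq] at hρ
  have hqA : q.1 ∈ invariantSet n d i Θ R''' R'' b₀ s₁ := ⟨q.2, hρ⟩
  obtain ⟨hgA, hgc'⟩ := hgO θ q.1 hqA (by linarith)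
  rw [monodromyMap_fold_coe b₀ g hgS]
  exact ⟨lt_of_lt_of_le hgA.2 (satRadius_le_cutRadius n d i Θ R''' R'' b₀ T ρW _), hgc'⟩

omit hd hΦ hΦs hΦt hr hφ hΘφ hns hTr hgc hg0 hg2π hgO hgF hs₀₁ hTr₂ in
/-- **Hypothesis `hgadd`** for `g` on the slice. [cite: ArnoldGuseinzadeVarchenko2012, Part I §2.1] -/
theorem monodromyMap_hgadd (θ θ' : ℝ) (q : pencilSlice n d i b₀) (hρ : s₁ ^ 2 < cutRadius n d i Θ R''' R'' b₀ T ρW q.1)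
    (hq : ‖pencilCoord n d i b₀ q.1‖ < δ₀) :
    restrictIf (pencilSlice n d i b₀) (fun x => g (θ + θ', x)) q =
      restrictIf (pencilSlice n d i b₀) (fun x => g (θ, x)) (restrictIf (pencilSlice n d i b₀) (fun x => g (θ', x)) q) := by
  rw [monodromyMap_cutRadius_eq b₀ Θ hρW hR hTR hT0 hδ₀ hq] at hρ
  apply Subtype.ext
  rw [monodromyMap_fold_coe b₀ g hgS, monodromyMap_fold_coe b₀ g hgS, monodromyMap_fold_coe b₀ g hgS]
  exact hgadd θ θ' q.1 ⟨q.2, hρ⟩ (by linarith)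

omit hd hΦ hΦs hΦt hr hφ hΘφ hns hTr hgc hg0 hg2π hgadd in
/-- **Hypothesis `hgρ`** for `g` on the slice: `cutRadius` is preserved on the controlled region.
[cite: ArnoldGuseinzadeVarchenko2012, Part I §2.1] -/
theorem monodromyMap_hgρ (θ : ℝ) (q : pencilSlice n d i b₀)
    (hρ : s₁ ^ 2 < cutRadius n d i Θ R''' R'' b₀ T ρW q.1)
    (hq : ‖pencilCoord n d i b₀ q.1‖ < δ₀) (hρT : cutRadius n d i Θ R''' R'' b₀ T ρW q.1 < T) :
    cutRadius n d i Θ R''' R'' b₀ T ρW (restrictIf (pencilSlice n d i b₀) (fun x => g (θ, x)) q).1 =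
      cutRadius n d i Θ R''' R'' b₀ T ρW q.1 := by
  rw [monodromyMap_cutRadius_eq b₀ Θ hρW hR hTR hT0 hδ₀ hq] at hρ hρT
  have hqA : q.1 ∈ invariantSet n d i Θ R''' R'' b₀ s₁ := ⟨q.2, hρ⟩
  obtain ⟨-, hgc'⟩ := hgO θ q.1 hqA (by linarith)
  rw [monodromyMap_fold_coe b₀ g hgS]
  refine cutRadius_congr n d i Θ R''' R'' b₀ T ρW (hgF θ q.1 q.2 (hs₀₁.trans hρ) (lt_of_lt_of_le hρT hTr₂)) ?_
  rw [hgc', norm_mul, Complex.norm_exp_ofReal_mul_I, one_mul]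

omit hd hΦ hΦs hΦt hr hφ hΘφ hρW hns hR hTR hTr hT0 hg0 hg2π hgO hgadd hgF hs₀₁ hTr₂ hδ₀ in
/-- `g` is continuous as a self-map of the slice. [cite: ArnoldGuseinzadeVarchenko2012, Part I §2.1] -/
theorem monodromyMap_hgcont :
    Continuous fun q : ℝ × pencilSlice n d i b₀ => restrictIf (pencilSlice n d i b₀) (fun x => g (q.1, x)) q.2 := by
  rw [Topology.IsInducing.subtypeVal.continuous_iff]
  have h : (Subtype.val ∘ fun q : ℝ × pencilSlice n d i b₀ => restrictIf (pencilSlice n d i b₀) (fun x => g (q.1, x)) q.2) =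
      fun q => g (q.1, q.2.1) := funext fun q => monodromyMap_fold_coe b₀ g hgS q.1 q.2
  rw [h]
  exact hgc.comp (continuous_fst.prodMk (continuous_subtype_val.comp continuous_snd))

/-! ### The monodromy map -/

/-- **The geometric monodromy map of a monomial pencil near a node, on the slice.** Radii `s₁² ≤ t₁ < t₂ ≤ T' < T`
(`T ≤ min(R''', r², r₂²)`), disc `|c| < δ₀ ≤ ρW/4`. There are self-maps `h, k, H` of `ℝ × S` such that, at the points `x ∈ S` with
`c(x) ≠ 0` (and `|c(x)| < δ₀` where indicated): `h` is continuous on `ℝ × {c ≠ 0}`; `h(0, x) = x`; `c(h(u, x)) = e^{2πiu} c(x)`,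
`F(h(u, x)) = F(x)` if `F(x) < T`, `F(h(u, x)) > T'` if `F(x) > T'`; `k(u, ·)` is a two-sided inverse of `h(u, ·)` covering the
rotation `c ↦ e^{−2πiu} c` and preserving `F` below `T` (so `h(u, ·) : X_c → X_{e^{2πiu}c}` is a bijection); `h(1, x) = x` if
`F(x) ≥ t₂`; and `H` is continuous on `ℝ × {F < T, 0 < |c| < δ₀}` with `c(H(s, x)) = c(x)`, `F(H(s, x)) = F(x)`, `H(0, x) = J(2π, x)`
(the model monodromy `Φ⁻¹(b'₀, Θ⁻¹(−Θ y(x)))`) and `H(1, x) = h(1, x)` if `F(x) ≤ T'`.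
[cite: ArnoldGuseinzadeVarchenko2012, Part I §1.1 and §2.1] [cite: Milnor1968, §9 Lemma 9.4] -/
theorem exists_pencil_monodromyMap (hΘ : ContDiffOn ℝ ∞ Θ Θ.source)
    (hR'' : {z : Fin (n + 1) → ℂ | ∑ j, ‖z j‖ ^ 2 ≤ R''} ⊆ Θ.target)
    {t₁ t₂ T' : ℝ} (ht₁ : s₁ ^ 2 ≤ t₁) (ht₁₂ : t₁ < t₂) (ht₂ : t₂ ≤ T') (hT' : T' < T) :
    ∃ h k H : ℝ × pencilSlice n d i b₀ → pencilSlice n d i b₀,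
      (Continuous fun ux : ℝ × {x : pencilSlice n d i b₀ // pencilCoord n d i b₀ x.1 ≠ 0} => h (ux.1, ux.2.1)) ∧
      (∀ x, pencilCoord n d i b₀ x.1 ≠ 0 → h (0, x) = x) ∧
      (∀ u x, pencilCoord n d i b₀ x.1 ≠ 0 → ‖pencilCoord n d i b₀ x.1‖ < δ₀ →
        pencilCoord n d i b₀ (h (u, x)).1 = Complex.exp (((2 * π * u : ℝ) : ℂ) * I) * pencilCoord n d i b₀ x.1 ∧
        (satRadius n d i Θ R''' R'' x.1 < T → satRadius n d i Θ R''' R'' (h (u, x)).1 = satRadius n d i Θ R''' R'' x.1) ∧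
        (T' < satRadius n d i Θ R''' R'' x.1 → T' < satRadius n d i Θ R''' R'' (h (u, x)).1) ∧
        k (u, h (u, x)) = x ∧ h (u, k (u, x)) = x ∧
        pencilCoord n d i b₀ (k (u, x)).1 = Complex.exp (((-(2 * π * u) : ℝ) : ℂ) * I) * pencilCoord n d i b₀ x.1 ∧
        (satRadius n d i Θ R''' R'' x.1 < T → satRadius n d i Θ R''' R'' (k (u, x)).1 = satRadius n d i Θ R''' R'' x.1)) ∧
      (∀ x, pencilCoord n d i b₀ x.1 ≠ 0 → ‖pencilCoord n d i b₀ x.1‖ < δ₀ → t₂ ≤ satRadius n d i Θ R''' R'' x.1 →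
        h (1, x) = x) ∧
      ContinuousOn H (univ ×ˢ {x : pencilSlice n d i b₀ |
        satRadius n d i Θ R''' R'' x.1 < T ∧ pencilCoord n d i b₀ x.1 ≠ 0 ∧ ‖pencilCoord n d i b₀ x.1‖ < δ₀}) ∧
      (∀ s x, pencilCoord n d i b₀ x.1 ≠ 0 → ‖pencilCoord n d i b₀ x.1‖ < δ₀ → satRadius n d i Θ R''' R'' x.1 < T →
        pencilCoord n d i b₀ (H (s, x)).1 = pencilCoord n d i b₀ x.1 ∧
        satRadius n d i Θ R''' R'' (H (s, x)).1 = satRadius n d i Θ R''' R'' x.1 ∧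
        (H (0, x)).1 = chartModelIsotopy (fun _ : Fin (n + 1) => 2) Φ Θ (2 * π) x.1 ∧
        (satRadius n d i Θ R''' R'' x.1 ≤ T' → H (1, x) = h (1, x))) := by
  -- the data of `ShellInterpolatedIsotopyPunctured` on `M = S`
  let ρ : pencilSlice n d i b₀ → ℝ := fun x => cutRadius n d i Θ R''' R'' b₀ T ρW x.1
  let pc : pencilSlice n d i b₀ → ℂ := fun x => pencilCoord n d i b₀ x.1
  let J : ℝ × pencilSlice n d i b₀ → pencilSlice n d i b₀ := fun q =>
    restrictIf (pencilSlice n d i b₀) (chartModelIsotopy (fun _ : Fin (n + 1) => 2) Φ Θ q.1) q.2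
  let G : ℝ × pencilSlice n d i b₀ → pencilSlice n d i b₀ := fun q =>
    restrictIf (pencilSlice n d i b₀) (fun x => g (q.1, x)) q.2
  let lam : ℝ → ℝ := fun t => Real.smoothTransition ((t - t₁) / (t₂ - t₁))
  have hρc : Continuous ρ :=
    (continuous_cutRadius n d i Θ R''' R'' b₀ T ρW hd hΘ hR hR'').comp continuous_subtype_val
  have hlam : Continuous lam :=
    Real.smoothTransition.continuous.comp ((continuous_id.sub continuous_const).div_const _)
  have hlam₀ : ∀ t, t ≤ t₁ → lam t = 0 := fun t ht =>
    Real.smoothTransition.zero_of_nonpos (div_nonpos_of_nonpos_of_nonneg (by linarith) (by linarith))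
  have hlam₁ : ∀ t, t₂ ≤ t → lam t = 1 := fun t ht =>
    Real.smoothTransition.one_of_one_le (by rw [le_div_iff₀ (by linarith)]; linarith)
  have hI : ∀ θ x, ρ x < T → pc x ≠ 0 → ρ (J (θ, x)) = ρ x ∧ pc (J (θ, x)) = Complex.exp ((θ : ℂ) * I) * pc x :=
    fun θ x hρ hc0 => monodromyMap_hI hd b₀ Φ hΦ hΦs hΦt Θ hr φ hφ hΘφ hρW hns hR hTR hTr θ x hρ hc0
  have hI0 : ∀ x, ρ x < T → pc x ≠ 0 → J (0, x) = x :=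
    fun x hρ hc0 => monodromyMap_hI0 hd b₀ Φ hΦ hΦs hΦt Θ hr φ hφ hΘφ hρW hns hR hTR hTr x hρ hc0
  have hIadd : ∀ θ θ' x, ρ x < T → pc x ≠ 0 → J (θ + θ', x) = J (θ, J (θ', x)) :=
    fun θ θ' x hρ hc0 => monodromyMap_hIadd hd b₀ Φ hΦ hΦs hΦt Θ hr φ hφ hΘφ hρW hns hR hTR hTr θ θ' x hρ hc0
  have hIcont : ContinuousOn J (univ ×ˢ {x | ρ x < T ∧ pc x ≠ 0}) :=
    monodromyMap_hIcont hd b₀ Φ hΦ hΦs hΦt Θ hr φ hφ hΘφ hρW hns hR hTR hTr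
  have hG0 : ∀ q, G (0, q) = q := fun q => restrictIf_of_apply_eq _ _ (hg0 q.1)
  have hG2π : ∀ q, G (2 * π, q) = q := fun q => restrictIf_of_apply_eq _ _ (hg2π q.1)
  have hGO : ∀ θ q, s₁ ^ 2 < ρ q → ‖pc q‖ < δ₀ → s₁ ^ 2 < ρ (G (θ, q)) ∧ pc (G (θ, q)) = Complex.exp ((θ : ℂ) * I) * pc q :=
    fun θ q hρ hq => monodromyMap_hgO b₀ Θ hρW hR hTR hT0 g hgO hgS hδ₀ θ q hρ hq
  have hGadd : ∀ θ θ' q, s₁ ^ 2 < ρ q → ‖pc q‖ < δ₀ → G (θ + θ', q) = G (θ, G (θ', q)) :=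
    fun θ θ' q hρ hq => monodromyMap_hgadd b₀ Θ hρW hR hTR hT0 g hgadd hgS hδ₀ θ θ' q hρ hq
  have hGρ : ∀ θ q, s₁ ^ 2 < ρ q → ‖pc q‖ < δ₀ → ρ q < T → ρ (G (θ, q)) = ρ q :=
    fun θ q hρ hq hρT => monodromyMap_hgρ b₀ Θ hρW hR hTR hT0 g hgO hgS hgF hs₀₁ hTr₂ hδ₀ θ q hρ hq hρT
  have hGcont : Continuous G := monodromyMap_hgcont b₀ g hgc hgS
  have hs₀₁' : s₁ ^ 2 ≤ t₁ := ht₁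
  -- the three maps
  refine ⟨fun ux => if ρ ux.2 ≤ T' then G (2 * π * ux.1 * lam (ρ ux.2), J (2 * π * ux.1 * (1 - lam (ρ ux.2)), ux.2))
      else G (2 * π * ux.1, ux.2),
    fun ux => if ρ ux.2 ≤ T' then J (-(2 * π * ux.1 * (1 - lam (ρ ux.2))), G (-(2 * π * ux.1 * lam (ρ ux.2)), ux.2))
      else G (-(2 * π * ux.1), ux.2),
    fun sx => G (2 * π * sx.1 * lam (ρ sx.2), J (2 * π * (1 - sx.1 * lam (ρ sx.2)), sx.2)),
    ?_, ?_, ?_, ?_, ?_, ?_⟩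
  · exact continuous_shellIsotopy' hρc ht₂ hT' hlam hlam₁ hIcont hI0 hGcont
  · intro x hx0
    exact shellIsotopy_zero' (lam := lam) hT' hI0 hG0 hx0
  · intro u x hx0 hxδ
    have hρx : ρ x = satRadius n d i Θ R''' R'' x.1 := monodromyMap_cutRadius_eq b₀ Θ hρW hR hTR hT0 hδ₀ hxδ
    obtain ⟨hpc, hρ₁, hρ₂⟩ := apply_shellIsotopy' hs₀₁' ht₁₂ ht₂ hT' hlam₀ hI hG0 hGO hGadd hGρ u hxδ hx0
    have hnorm : ‖pc (if ρ x ≤ T' then G (2 * π * u * lam (ρ x), J (2 * π * u * (1 - lam (ρ x)), x))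
        else G (2 * π * u, x))‖ < δ₀ := by
      rw [hpc, norm_mul, Complex.norm_exp_ofReal_mul_I, one_mul]; exact hxδ
    have hρh := monodromyMap_cutRadius_eq b₀ Θ hρW hR hTR hT0 hδ₀ hnorm
    obtain ⟨hpk, hρk⟩ := apply_shellInverse' hs₀₁' ht₁₂ ht₂ hT' hlam₀ hI hG0 hGO hGρ u hxδ hx0
    have hnormk : ‖pc (if ρ x ≤ T' then J (-(2 * π * u * (1 - lam (ρ x))), G (-(2 * π * u * lam (ρ x)), x))
        else G (-(2 * π * u), x))‖ < δ₀ := by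
      rw [hpk, norm_mul, Complex.norm_exp_ofReal_mul_I, one_mul]; exact hxδ
    have hρhk := monodromyMap_cutRadius_eq b₀ Θ hρW hR hTR hT0 hδ₀ hnormk
    refine ⟨hpc, fun hF => ?_, fun hF => ?_, ?_, ?_, hpk, fun hF => ?_⟩
    · have h := hρ₁ (by rw [hρx]; exact hF)
      exact hρh.symm.trans (h.trans hρx)
    · have h := hρ₂ (by rw [hρx]; exact hF)
      exact lt_of_lt_of_eq h hρh
    · exact shellIsotopy_leftInverse' hs₀₁' ht₁₂ ht₂ hT' hlam₀ hI hI0 hIadd hG0 hGO hGadd hGρ u hxδ hx0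
    · exact shellIsotopy_rightInverse' hs₀₁' ht₁₂ ht₂ hT' hlam₀ hI hI0 hIadd hG0 hGO hGadd hGρ u hxδ hx0
    · have h := hρk (by rw [hρx]; exact hF)
      exact hρhk.symm.trans (h.trans hρx)
  · intro x hx0 hxδ hF
    have hρx : ρ x = satRadius n d i Θ R''' R'' x.1 := monodromyMap_cutRadius_eq b₀ Θ hρW hR hTR hT0 hδ₀ hxδ
    exact shellIsotopy_one_of_ge' hT' hlam₁ hI0 hG2π (by rw [hρx]; exact hF) hx0
  · refine (continuousOn_shellHomotopy' hρc hlam hIcont hGcont).mono (prod_mono le_rfl ?_)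
    rintro x ⟨hF, hx0, hxδ⟩
    have hρx : ρ x = satRadius n d i Θ R''' R'' x.1 := monodromyMap_cutRadius_eq b₀ Θ hρW hR hTR hT0 hδ₀ hxδ
    exact ⟨by rw [hρx]; exact hF, hx0⟩
  · intro s x hx0 hxδ hF
    have hρx : ρ x = satRadius n d i Θ R''' R'' x.1 := monodromyMap_cutRadius_eq b₀ Θ hρW hR hTR hT0 hδ₀ hxδ
    have hρT : ρ x < T := by rw [hρx]; exact hF
    obtain ⟨hpc, hρH, hH0, hH1⟩ := apply_shellHomotopy' hs₀₁' hlam₀ hI hG0 hGO hGρ s hxδ hx0 hρT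
    have hnorm : ‖pc (G (2 * π * s * lam (ρ x), J (2 * π * (1 - s * lam (ρ x)), x)))‖ < δ₀ := by rw [hpc]; exact hxδ
    have hρh := monodromyMap_cutRadius_eq b₀ Θ hρW hR hTR hT0 hδ₀ hnorm
    refine ⟨hpc, hρh.symm.trans (hρH.trans hρx), ?_, fun hF' => hH1 (by rw [hρx]; exact hF')⟩
    change (G (2 * π * (0 : ℝ) * lam (ρ x), J (2 * π * (1 - (0 : ℝ) * lam (ρ x)), x))).1 = _
    rw [hH0]
    obtain ⟨hF', hcρ⟩ := monodromyMap_good_of_cutRadius_lt b₀ Θ hρW hρT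
    exact monodromyMap_model_coe hd b₀ Φ hΦ hΦs hΦt Θ hr φ hφ hΘφ hns hR hTR hTr hF' hx0 hcρ (2 * π)

end MonodromyMap

end NodalPencil

end Literature.AlgebraicGeometry.HodgeTheory

end
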